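import Literature.Algebra.Homology.OrderedCechSystemFullRefine
import Literature.Algebra.Homology.OrderedCechSystemRefineMap
import Mathlib.Algebra.Homology.Homotopy
import HarnessLib

/-!
# Refinement along two CONTIGUOUS index maps: the prism homotopy on the full Čech complex of a system, its transport to
# the ordered complex, the refinement chain map, and index-map independence on classes
# (The Stacks Project, Tag 01FP; Serre FAC n° 29; Godement II §5.8)

Layer `Algebra/Homology` (pure algebra).  DEF-kind file (definitions + unfolding lemmas + theorems; no instance, no notation,
no attribute games, no named fact, no `sorry`).  Cell `hodgecm-mathlib` FLOOR 0, P1 sub-line F-11, packet (iv)∕J3, (G1) «pull-backs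
on classes», letters **(G1-b)** (index-map independence) with the chain-map packaging of ★ core-1 `refineCochain` (F0P1b-plan (g0)
(R56)∕(R60)∕(R62) DEF #13; B-p10 (g15)).  HC_CM is proved only modulo the 7 printed citations until rung 0 closes — nothing here
bears on a summit statement.

THE PRINT. [StacksProject, Tag 01FP]: given a refinement `𝓥 → 𝓤` and TWO choices `θ, θ' : J → I` with `V_j ⊆ U_{θ j} ∩ U_{θ' j}`,
«the maps `θ^*`, `θ'^* : Č(𝓤, 𝓕) → Č(𝓥, 𝓕)` are homotopic», by the prism operator
`(h s)_{j₀…j_n} = Σ_p (-1)^p s_{θ j₀ … θ j_p θ' j_p … θ' j_n}|_{V_{j₀…j_n}}` on FULL cochains (all tuples); the homotopy identity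
`d h + h d = θ'^* − θ^*` is the usual cancellation of adjacent prisms (Serre FAC n° 29; Godement II 5.8).  For the ORDERED complex
★ `OrderedCech.sysComplex` (components on increasing tuples only) the operator is transported through ★ F-F `Full.res`∕`Full.ext`:
`h_ord := res ∘ h ∘ ext` is a homotopy `refine_{θ'} − refine_θ = d h_ord + h_ord d` because `res`, `ext` are cochain maps
(★ `Full.sysD_res`, ★ `Full.d_ext`) and `res ∘ Θ_θ ∘ ext = refine_θ` (★ `Full.res_pullbackCochain_ext`, F0P1b-p01 (g0)).

SETTING. Systems `M : Finset ι ⥤ ModuleCat A`, `M' : Finset ι' ⥤ ModuleCat A` on linearly ordered index types; two index maps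
`θ θ' : ι' → ι`; a JOINT restriction datum (def-free hypotheses, the house style): linear maps
`ψ s' : M (θ s' ∪ θ' s') → M' s'` natural in `s'` (`hψ`), through which the two restriction data `φ : imageFunctor θ ⋙ M ⟶ M'`,
`φ' : imageFunctor θ' ⋙ M ⟶ M'` factor (`hφ`, `hφ'`) — in geometry: `V_{s'} ⊆ U_{θ s'} ∩ U_{θ' s'} = U_{θ s' ∪ θ' s'}`.

* §1 `Full.prismTuple θ θ' p α` — the prism vertex list `(θα₀,…,θα_p, θ'α_p,…,θ'α_n)`; its five face identities
  (`val_succAbove_eq_add_ite`, `prismTuple_succ_comp_succAbove_of_le`, `prismTuple_comp_succAbove_of_lt`, `prismTuple_castSucc_comp_succAbove_succ`,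
  `prismTuple_zero_comp_succAbove_zero`, `prismTuple_last_comp_succAbove_last`).
* §2 `Full.prismMap θ θ' ψ p`, `Full.prismHomotopy θ θ' ψ n = Σ_p (-1)^p prismMap p : F^{n+1}(M) → F^n(M')` and
  **`Full.prismHomotopy_d_add_d_prismHomotopy`**: `h (d c) + d' (h c) = Θ_{θ'} c − Θ_θ c` (and the degree-`0` form).
* §3 TRANSPORT: `refineHomotopyMap θ θ' ψ n := res ∘ prismHomotopy n ∘ ext` and **`refineCochain_sub_refineCochain_eq`**:
  `refine_{θ'} g − refine_θ g = sysD (h_ord g) + h_ord (sysD g)` on ordered cochains (degree `0`: `= h_ord (sysD g)`).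
* §4 **(G1-b) on classes**: `homologyMap_eq_of_refine` (for CHARACTERISED chain maps `F`, `F'` whose components are
  `refineCochain θ φ n`, `refineCochain θ' φ' n`) and `homologyMap_refineComplexMap_eq` for the refinement chain maps
  ★ `OrderedCech.refineComplexMap` (DEF #15, `Algebra/Homology/OrderedCechSystemRefineMap`, F0P1b-p02 (g2)): `H(F) = H(F')` in
  every degree (on cycles `F' z − F z = d (h_ord z)` is a boundary; degree `0`: `= h_ord (d z) = 0`; negative degrees are zero).

## References
* The Stacks Project, Tag 01FP (refinements: independence of the refinement map up to homotopy), Tag 01FG (Čech complexes). [StacksProject]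
* J.-P. Serre, *Faisceaux algébriques cohérents*, Ann. of Math. 61 (1955), n° 29. [folklore]
* R. Godement, *Topologie algébrique et théorie des faisceaux* (1958), II §5.8. [folklore]
* U. Görtz, T. Wedhorn, *Algebraic Geometry II* (2023), Def. 21.64, Def. 21.68 (pp. 179–181). [GortzWedhorn2023]
-/

universe v u

open CategoryTheory

set_option backward.isDefEq.respectTransparency false -- `ModuleCat`-valued functors (as in ★ `OrderedCechSystem`)

noncomputable section

namespace Literature.Algebra.Homology

namespace OrderedCech

namespace Full

variable {ι : Type} [LinearOrder ι] {ι' : Type} [LinearOrder ι'] {A : Type u} [CommRing A]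

/-! ## §1 The prism tuples and their faces -/

section PrismTuple

variable (θ θ' : ι' → ι)

omit [LinearOrder ι] [LinearOrder ι'] in
/-- **The prism vertex list** `ω_p α = (θα₀, …, θα_p, θ'α_p, …, θ'α_n)` of an `(n+1)`-tuple `α` at the position `p`
(length `n + 2`): position `i ≤ p` carries `θ α_i`, position `i ≥ p + 1` carries `θ' α_{i-1}`. [cite: StacksProject, Tag 01FP] -/
def prismTuple {n : ℕ} (p : Fin (n + 1)) (α : Fin (n + 1) → ι') : Fin (n + 2) → ι := fun i =>
  if h : (i : ℕ) ≤ p then θ (α ⟨i, by omega⟩) else θ' (α ⟨i - 1, by omega⟩)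

omit [LinearOrder ι] [LinearOrder ι'] in
/-- Value of the prism tuple at a position `≤ p`. [cite: StacksProject, Tag 01FP] -/
theorem prismTuple_apply_of_le {n : ℕ} (p : Fin (n + 1)) (α : Fin (n + 1) → ι') (i : Fin (n + 2)) (h : (i : ℕ) ≤ p) :
    prismTuple θ θ' p α i = θ (α ⟨i, by omega⟩) := by
  unfold prismTuple; rw [dif_pos h]

omit [LinearOrder ι] [LinearOrder ι'] in
/-- Value of the prism tuple at a position `> p`. [cite: StacksProject, Tag 01FP] -/
theorem prismTuple_apply_of_lt {n : ℕ} (p : Fin (n + 1)) (α : Fin (n + 1) → ι') (i : Fin (n + 2)) (h : (p : ℕ) < i) :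
    prismTuple θ θ' p α i = θ' (α ⟨i - 1, by omega⟩) := by
  unfold prismTuple; rw [dif_neg (by omega)]

omit [LinearOrder ι] [LinearOrder ι'] in
/-- The value of a face map `δ_j` on positions, as a shift: `x ↦ x + 0` below `j`, `x ↦ x + 1` from `j` on (prism bookkeeping
form). [cite: StacksProject, Tag 01FG] -/
theorem val_succAbove_eq_add_ite {m : ℕ} (j : Fin (m + 1)) (x : Fin m) :
    ((j.succAbove x : Fin (m + 1)) : ℕ) = (x : ℕ) + (if (x : ℕ) < j then 0 else 1) := by
  by_cases h : (x : ℕ) < j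
  · rw [Fin.succAbove_of_castSucc_lt j x (by rwa [Fin.lt_def, Fin.val_castSucc]), if_pos h, Fin.val_castSucc, add_zero]
  · rw [Fin.succAbove_of_le_castSucc j x (by rw [Fin.le_def, Fin.val_castSucc]; omega), if_neg h, Fin.val_succ]

omit [LinearOrder ι] [LinearOrder ι'] in
/-- The images of all prism tuples lie in `θ(α) ∪ θ'(α)`. [cite: StacksProject, Tag 01FP] -/
theorem image_prismTuple_subset [DecidableEq ι] [DecidableEq ι'] {n : ℕ} (p : Fin (n + 1)) (α : Fin (n + 1) → ι') :
    Finset.univ.image (prismTuple θ θ' p α) ⊆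
      (Finset.univ.image α).image θ ∪ (Finset.univ.image α).image θ' := by
  intro x hx
  obtain ⟨i, -, rfl⟩ := Finset.mem_image.mp hx
  by_cases h : (i : ℕ) ≤ p
  · rw [prismTuple_apply_of_le θ θ' p α i h]
    exact Finset.mem_union_left _ (Finset.mem_image_of_mem θ (Finset.mem_image_of_mem α (Finset.mem_univ _)))
  · rw [prismTuple_apply_of_lt θ θ' p α i (by omega)]
    exact Finset.mem_union_right _ (Finset.mem_image_of_mem θ' (Finset.mem_image_of_mem α (Finset.mem_univ _)))

omit [LinearOrder ι] [LinearOrder ι'] in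
/-- **Face below the joint: `δ_j ω_{q+1} α = ω_q (δ_j α)` for `j ≤ q`** (deleting a `θ`-vertex). [cite: StacksProject, Tag 01FP] -/
theorem prismTuple_succ_comp_succAbove_of_le {n : ℕ} (q : Fin (n + 1)) (j : Fin (n + 2)) (hjq : (j : ℕ) ≤ q)
    (α : Fin (n + 2) → ι') :
    prismTuple θ θ' q.succ α ∘ Fin.succAbove (j.castSucc : Fin (n + 3)) = prismTuple θ θ' q (α ∘ Fin.succAbove j) := by
  funext x
  simp only [Function.comp_apply]
  have hv := val_succAbove_eq_add_ite (j.castSucc : Fin (n + 3)) x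
  rw [Fin.val_castSucc] at hv
  by_cases hx : (x : ℕ) ≤ q
  · rw [prismTuple_apply_of_le θ θ' q _ x hx, prismTuple_apply_of_le θ θ' q.succ α _ (by rw [hv, Fin.val_succ]; split_ifs <;> omega)]
    congr 1
    have hv' := val_succAbove_eq_add_ite j ⟨x, by omega⟩
    refine congrArg α (Fin.ext ?_)
    simp only [hv, hv']
  · rw [prismTuple_apply_of_lt θ θ' q _ x (by omega), prismTuple_apply_of_lt θ θ' q.succ α _ (by rw [hv, Fin.val_succ]; split_ifs <;> omega)]
    congr 1
    have hv' := val_succAbove_eq_add_ite j ⟨x - 1, by omega⟩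
    refine congrArg α (Fin.ext ?_)
    simp only [hv']
    rw [hv]
    split_ifs <;> omega

omit [LinearOrder ι] [LinearOrder ι'] in
/-- **Face above the joint: `δ_{j+1} ω_q α = ω_q (δ_j α)` for `q < j`** (deleting a `θ'`-vertex). [cite: StacksProject, Tag 01FP] -/
theorem prismTuple_comp_succAbove_of_lt {n : ℕ} (q : Fin (n + 1)) (j : Fin (n + 2)) (hqj : (q : ℕ) < j)
    (α : Fin (n + 2) → ι') :
    prismTuple θ θ' q.castSucc α ∘ Fin.succAbove (j.succ : Fin (n + 3)) = prismTuple θ θ' q (α ∘ Fin.succAbove j) := by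
  funext x
  simp only [Function.comp_apply]
  have hv := val_succAbove_eq_add_ite (j.succ : Fin (n + 3)) x
  rw [Fin.val_succ] at hv
  by_cases hx : (x : ℕ) ≤ q
  · rw [prismTuple_apply_of_le θ θ' q _ x hx, prismTuple_apply_of_le θ θ' q.castSucc α _ (by rw [hv, Fin.val_castSucc]; split_ifs <;> omega)]
    congr 1
    have hv' := val_succAbove_eq_add_ite j ⟨x, by omega⟩
    refine congrArg α (Fin.ext ?_)
    simp only [hv']
    rw [hv]
    split_ifs <;> omega
  · rw [prismTuple_apply_of_lt θ θ' q _ x (by omega), prismTuple_apply_of_lt θ θ' q.castSucc α _ (by rw [hv, Fin.val_castSucc]; split_ifs <;> omega)]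
    congr 1
    have hv' := val_succAbove_eq_add_ite j ⟨x - 1, by omega⟩
    refine congrArg α (Fin.ext ?_)
    simp only [hv']
    rw [hv]
    split_ifs <;> omega

omit [LinearOrder ι] [LinearOrder ι'] in
/-- **Adjacent prisms share the face through the joint: `δ_{q+1} ω_q α = δ_{q+1} ω_{q+1} α`.** [cite: StacksProject, Tag 01FP] -/
theorem prismTuple_castSucc_comp_succAbove_succ {n : ℕ} (q : Fin (n + 1)) (α : Fin (n + 2) → ι') :
    prismTuple θ θ' q.castSucc α ∘ Fin.succAbove (q.succ.castSucc : Fin (n + 3)) =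
      prismTuple θ θ' q.succ α ∘ Fin.succAbove (q.succ.castSucc : Fin (n + 3)) := by
  funext x
  simp only [Function.comp_apply]
  have hv := val_succAbove_eq_add_ite (q.succ.castSucc : Fin (n + 3)) x
  rw [Fin.val_castSucc, Fin.val_succ] at hv
  by_cases hx : (x : ℕ) ≤ q
  · rw [prismTuple_apply_of_le θ θ' q.castSucc α _ (by rw [hv, Fin.val_castSucc]; split_ifs <;> omega),
      prismTuple_apply_of_le θ θ' q.succ α _ (by rw [hv, Fin.val_succ]; split_ifs <;> omega)]
  · rw [prismTuple_apply_of_lt θ θ' q.castSucc α _ (by rw [hv, Fin.val_castSucc]; split_ifs <;> omega),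
      prismTuple_apply_of_lt θ θ' q.succ α _ (by rw [hv, Fin.val_succ]; split_ifs <;> omega)]

omit [LinearOrder ι] [LinearOrder ι'] in
/-- **The bottom face of the first prism is the `θ'`-tuple: `δ₀ ω₀ α = θ' ∘ α`.** [cite: StacksProject, Tag 01FP] -/
theorem prismTuple_zero_comp_succAbove_zero {n : ℕ} (α : Fin (n + 1) → ι') :
    prismTuple θ θ' (0 : Fin (n + 1)) α ∘ Fin.succAbove (0 : Fin (n + 2)) = θ' ∘ α := by
  funext x
  simp only [Function.comp_apply, Fin.succAbove_zero]
  rw [prismTuple_apply_of_lt θ θ' 0 α x.succ (by rw [Fin.val_succ]; exact Nat.succ_pos _)]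
  exact congrArg (fun y => θ' (α y)) (Fin.ext (by simp))

omit [LinearOrder ι] [LinearOrder ι'] in
/-- **The top face of the last prism is the `θ`-tuple: `δ_{n+1} ω_n α = θ ∘ α`.** [cite: StacksProject, Tag 01FP] -/
theorem prismTuple_last_comp_succAbove_last {n : ℕ} (α : Fin (n + 1) → ι') :
    prismTuple θ θ' (Fin.last n) α ∘ Fin.succAbove (Fin.last (n + 1)) = θ ∘ α := by
  funext x
  simp only [Function.comp_apply, Fin.succAbove_last]
  rw [prismTuple_apply_of_le θ θ' (Fin.last n) α x.castSucc (by rw [Fin.val_castSucc, Fin.val_last]; omega)]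
  exact congrArg (fun y => θ (α y)) (Fin.ext (by simp))

end PrismTuple

/-! ## §2 The prism operator on full cochains and the homotopy identity -/

section Prism

open Finset in
omit [LinearOrder ι] [LinearOrder ι'] in
/-- **The sign bookkeeping of the prism homotopy** (pure combinatorics): with `X p i` «the `i`-th face of the `p`-th prism» and
`Y j q` «the `q`-th prism of the `j`-th face», the face relations (below∕above the joint, adjacent prisms) give
`Σ_{p,i} (-1)^{p+i} X p i + Σ_{j,q} (-1)^{j+q} Y j q = X 0 0 − X last last` — the off-diagonal terms cancel in pairs against the
second sum, the diagonal telescopes. [cite: StacksProject, Tag 01FP] -/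
theorem prism_sum_identity {V : Type*} [AddCommGroup V] [Module A V] {n : ℕ} (X : Fin (n + 2) → Fin (n + 3) → V) (Y : Fin (n + 2) → Fin (n + 1) → V)
    (hT1 : ∀ (q : Fin (n + 1)) (j : Fin (n + 2)), (j : ℕ) ≤ q → X q.succ j.castSucc = Y j q)
    (hT4 : ∀ (q : Fin (n + 1)) (j : Fin (n + 2)), (q : ℕ) < j → X q.castSucc j.succ = Y j q)
    (hT23 : ∀ q : Fin (n + 1), X q.castSucc q.succ.castSucc = X q.succ q.succ.castSucc) :
    (∑ p : Fin (n + 2), ∑ i : Fin (n + 3), ((-1 : A) ^ (p : ℕ) * (-1) ^ (i : ℕ)) • X p i) +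
      (∑ j : Fin (n + 2), ∑ q : Fin (n + 1), ((-1 : A) ^ (j : ℕ) * (-1) ^ (q : ℕ)) • Y j q) =
      X 0 0 - X (Fin.last (n + 1)) (Fin.last (n + 2)) := by
  -- pass to sums over pairs
  set a : Fin (n + 2) × Fin (n + 3) → V := fun x => ((-1 : A) ^ (x.1 : ℕ) * (-1) ^ (x.2 : ℕ)) • X x.1 x.2 with ha
  set b : Fin (n + 2) × Fin (n + 1) → V := fun y => ((-1 : A) ^ (y.1 : ℕ) * (-1) ^ (y.2 : ℕ)) • Y y.1 y.2 with hb
  have hA : (∑ p : Fin (n + 2), ∑ i : Fin (n + 3), ((-1 : A) ^ (p : ℕ) * (-1) ^ (i : ℕ)) • X p i) =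
      ∑ x ∈ (univ : Finset (Fin (n + 2))) ×ˢ (univ : Finset (Fin (n + 3))), a x := by
    rw [Finset.sum_product]
  have hB : (∑ j : Fin (n + 2), ∑ q : Fin (n + 1), ((-1 : A) ^ (j : ℕ) * (-1) ^ (q : ℕ)) • Y j q) =
      ∑ y ∈ (univ : Finset (Fin (n + 2))) ×ˢ (univ : Finset (Fin (n + 1))), b y := by
    rw [Finset.sum_product]
  rw [hA, hB]
  -- the diagonal set `D = {(p, p), (p, p+1)}` and its complement
  let PD : Fin (n + 2) × Fin (n + 3) → Prop := fun x => (x.2 : ℕ) = x.1 ∨ (x.2 : ℕ) = x.1 + 1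
  rw [← Finset.sum_filter_add_sum_filter_not (univ ×ˢ univ) PD a]
  -- (I) the off-diagonal part is `- Σ b` (faces below / above the joint)
  have hI : ∑ x ∈ (univ ×ˢ univ).filter (fun x => ¬ PD x), a x =
      - ∑ y ∈ (univ : Finset (Fin (n + 2))) ×ˢ (univ : Finset (Fin (n + 1))), b y := by
    rw [← Finset.sum_neg_distrib]
    symm
    refine Finset.sum_nbij'
      (fun y : Fin (n + 2) × Fin (n + 1) =>
        (⟨(y.2 : ℕ) + (1 - ((y.1 : ℕ) - y.2)), by have := y.2.isLt; omega⟩,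
          ⟨(y.1 : ℕ) + (((y.1 : ℕ) - y.2) - ((y.1 : ℕ) - y.2 - 1)), by have := y.1.isLt; omega⟩))
      (fun x : Fin (n + 2) × Fin (n + 3) =>
        (⟨(x.2 : ℕ) - (((x.2 : ℕ) - x.1) - ((x.2 : ℕ) - x.1 - 1)), by have := x.2.isLt; have := x.1.isLt; omega⟩,
          ⟨(x.1 : ℕ) - (1 - ((x.2 : ℕ) - x.1 - 1)), by have := x.2.isLt; have := x.1.isLt; omega⟩))
      ?_ ?_ ?_ ?_ ?_
    · rintro ⟨j, q⟩ -
      have hj := j.isLt; have hq := q.isLt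
      simp only [Finset.mem_filter, Finset.mem_product, Finset.mem_univ, true_and, PD, not_or]
      omega
    · intro x _
      exact Finset.mem_product.mpr ⟨Finset.mem_univ _, Finset.mem_univ _⟩
    · rintro ⟨j, q⟩ -
      have hj := j.isLt; have hq := q.isLt
      simp only [Prod.mk.injEq, Fin.ext_iff]
      omega
    · rintro ⟨p, i⟩ hx
      have hp := p.isLt; have hi := i.isLt
      simp only [Finset.mem_filter, Finset.mem_product, Finset.mem_univ, true_and, PD] at hx
      simp only [Prod.mk.injEq, Fin.ext_iff]
      omega
    · rintro ⟨j, q⟩ -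
      have hj := j.isLt; have hq := q.isLt
      simp only [hb, ha]
      by_cases h : (j : ℕ) ≤ q
      · have e1 : (⟨(q : ℕ) + (1 - ((j : ℕ) - q)), by omega⟩ : Fin (n + 2)) = q.succ := Fin.ext (by simp; omega)
        have e2 : (⟨(j : ℕ) + (((j : ℕ) - q) - ((j : ℕ) - q - 1)), by omega⟩ : Fin (n + 3)) = j.castSucc :=
          Fin.ext (by simp; omega)
        have x1 : (q : ℕ) + (1 - ((j : ℕ) - q)) = q + 1 := by omega
        have x2 : (j : ℕ) + (((j : ℕ) - q) - ((j : ℕ) - q - 1)) = j := by omega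
        rw [e1, e2, hT1 q j h, x1, x2, pow_succ]
        simp only [mul_neg, mul_one, neg_mul, neg_smul]
        rw [mul_comm]
      · have e1 : (⟨(q : ℕ) + (1 - ((j : ℕ) - q)), by omega⟩ : Fin (n + 2)) = q.castSucc := Fin.ext (by simp; omega)
        have e2 : (⟨(j : ℕ) + (((j : ℕ) - q) - ((j : ℕ) - q - 1)), by omega⟩ : Fin (n + 3)) = j.succ :=
          Fin.ext (by simp; omega)
        have x1 : (q : ℕ) + (1 - ((j : ℕ) - q)) = q := by omega
        have x2 : (j : ℕ) + (((j : ℕ) - q) - ((j : ℕ) - q - 1)) = j + 1 := by omega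
        rw [e1, e2, hT4 q j (by omega), x1, x2, pow_succ]
        simp only [mul_neg, mul_one, neg_smul]
        rw [mul_comm]
  -- (II) the diagonal part telescopes to `X 0 0 - X last last`
  have hD : (univ ×ˢ univ).filter PD =
      (univ.image fun p : Fin (n + 2) => (p, (p.castSucc : Fin (n + 3)))) ∪
        (univ.image fun p : Fin (n + 2) => (p, (p.succ : Fin (n + 3)))) := by
    ext ⟨p, i⟩
    simp only [Finset.mem_filter, Finset.mem_product, Finset.mem_univ, true_and, Finset.mem_union, Finset.mem_image,
      Prod.mk.injEq, PD]
    constructor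
    · rintro (h | h)
      · exact Or.inl ⟨p, rfl, Fin.ext (by simp [h])⟩
      · exact Or.inr ⟨p, rfl, Fin.ext (by simp [h])⟩
    · rintro (⟨p', rfl, rfl⟩ | ⟨p', rfl, rfl⟩)
      · exact Or.inl (by simp)
      · exact Or.inr (by simp)
  have hdisj : Disjoint (univ.image fun p : Fin (n + 2) => (p, (p.castSucc : Fin (n + 3))))
      (univ.image fun p : Fin (n + 2) => (p, (p.succ : Fin (n + 3)))) := by
    rw [Finset.disjoint_iff_ne]
    rintro _ hx _ hy rfl
    obtain ⟨p, -, rfl⟩ := Finset.mem_image.mp hx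
    obtain ⟨p', -, hp'⟩ := Finset.mem_image.mp hy
    simp only [Prod.mk.injEq] at hp'
    obtain ⟨rfl, h2⟩ := hp'
    exact absurd (congrArg Fin.val h2) (by simp)
  have hII : ∑ x ∈ (univ ×ˢ univ).filter PD, a x = X 0 0 - X (Fin.last (n + 1)) (Fin.last (n + 2)) := by
    rw [hD, Finset.sum_union hdisj,
      Finset.sum_image (fun p _ p' _ h => (Prod.ext_iff.mp h).1),
      Finset.sum_image (fun p _ p' _ h => (Prod.ext_iff.mp h).1)]
    have h1 : ∀ p : Fin (n + 2), a (p, (p.castSucc : Fin (n + 3))) = X p p.castSucc := fun p => by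
      simp only [ha, Fin.val_castSucc, ← pow_add, (Even.add_self _).neg_one_pow, one_smul]
    have h2 : ∀ p : Fin (n + 2), a (p, (p.succ : Fin (n + 3))) = -X p p.succ := fun p => by
      have hs : (-1 : A) ^ (p : ℕ) * (-1) ^ ((p : ℕ) + 1) = -1 := by
        rw [pow_succ, ← mul_assoc, ← pow_add, (Even.add_self _).neg_one_pow, one_mul]
      simp only [ha, Fin.val_succ, hs, neg_smul, one_smul]
    simp_rw [h1, h2, Finset.sum_neg_distrib]
    have e1 : ∑ p : Fin (n + 2), X p p.castSucc = X 0 0 + ∑ q : Fin (n + 1), X q.succ q.succ.castSucc := by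
      rw [Fin.sum_univ_succ]; rfl
    have e2 : ∑ p : Fin (n + 2), X p p.succ =
        (∑ q : Fin (n + 1), X q.succ q.succ.castSucc) + X (Fin.last (n + 1)) (Fin.last (n + 2)) := by
      rw [Fin.sum_univ_castSucc]
      congr 1
      refine Finset.sum_congr rfl fun q _ => ?_
      have hq : (q.castSucc : Fin (n + 2)).succ = (q.succ.castSucc : Fin (n + 3)) := Fin.ext (by simp)
      rw [hq]
      exact hT23 q
    rw [e1, e2]
    abel
  rw [hI, hII]
  abel

variable {M : Finset ι ⥤ ModuleCat.{v} A} {M' : Finset ι' ⥤ ModuleCat.{v} A} (θ θ' : ι' → ι)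
  (ψ : ∀ s' : Finset ι', M.obj (s'.image θ ∪ s'.image θ') →ₗ[A] M'.obj s')

/-- **The `p`-th prism operator** `h_p : F^{n+1}(M) → F^n(M')`, `(h_p c)(α) = ψ_{ {α} } (c(ω_p α)|)`. [cite: StacksProject, Tag 01FP] -/
def prismMap {n : ℕ} (p : Fin (n + 1)) : Cochain M (n + 1) →ₗ[A] Cochain M' n where
  toFun c α := ψ (Finset.univ.image α)
    ((M.map (homOfLE (image_prismTuple_subset θ θ' p α))).hom (c (prismTuple θ θ' p α)))
  map_add' c c' := by
    funext α
    change ψ _ ((M.map _).hom (c _ + c' _)) = ψ _ _ + ψ _ _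
    rw [map_add, map_add]
  map_smul' a c := by
    funext α
    change ψ _ ((M.map _).hom (a • c _)) = a • ψ _ _
    rw [map_smul, map_smul]

/-- Components of the prism operator. [cite: StacksProject, Tag 01FP] -/
theorem prismMap_apply {n : ℕ} (p : Fin (n + 1)) (c : Cochain M (n + 1)) (α : Fin (n + 1) → ι') :
    prismMap θ θ' ψ p c α = ψ (Finset.univ.image α)
      ((M.map (homOfLE (image_prismTuple_subset θ θ' p α))).hom (c (prismTuple θ θ' p α))) := rfl

/-- **The prism homotopy operator** `h = Σ_p (-1)^p h_p : F^{n+1}(M) → F^n(M')`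
(`(h c)(α₀…α_n) = Σ_p (-1)^p c(θα₀ … θα_p θ'α_p … θ'α_n)|`). [cite: StacksProject, Tag 01FP] -/
def prismHomotopy (n : ℕ) : Cochain M (n + 1) →ₗ[A] Cochain M' n :=
  ∑ p : Fin (n + 1), ((-1 : A) ^ (p : ℕ)) • prismMap θ θ' ψ p

/-- Components of the prism homotopy operator. [cite: StacksProject, Tag 01FP] -/
theorem prismHomotopy_apply (n : ℕ) (c : Cochain M (n + 1)) (α : Fin (n + 1) → ι') :
    prismHomotopy θ θ' ψ n c α = ∑ p : Fin (n + 1), ((-1 : A) ^ (p : ℕ)) •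
      ψ (Finset.univ.image α) ((M.map (homOfLE (image_prismTuple_subset θ θ' p α))).hom (c (prismTuple θ θ' p α))) := by
  simp only [prismHomotopy, LinearMap.coe_sum, Finset.sum_apply, LinearMap.smul_apply, Pi.smul_apply, prismMap_apply]

/-- `h(dc)` expanded: `Σ_p Σ_i (-1)^{p+i} ψ(c(δ_i ω_p α)|)`. [cite: StacksProject, Tag 01FP] -/
theorem prismHomotopy_d_apply (n : ℕ) (c : Cochain M (n + 1)) (α : Fin (n + 2) → ι') :
    prismHomotopy θ θ' ψ (n + 1) (((complex M).d (n + 1) (n + 2)).hom c) α =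
      ∑ p : Fin (n + 2), ∑ i : Fin (n + 3), ((-1 : A) ^ (p : ℕ) * (-1) ^ (i : ℕ)) •
        ψ (Finset.univ.image α) ((M.map (homOfLE ((image_comp_subset _ (Fin.succAbove i)).trans
          (image_prismTuple_subset θ θ' p α)))).hom (c (prismTuple θ θ' p α ∘ Fin.succAbove i))) := by
  rw [prismHomotopy_apply]
  refine Finset.sum_congr rfl fun p _ => ?_
  rw [complex_d_apply, map_sum, map_sum, Finset.smul_sum]
  refine Finset.sum_congr rfl fun i _ => ?_
  rw [neg_one_pow_zsmul (A := A), map_smul, map_smul, smul_smul, map_map_apply]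

/-- `d'(hc)` expanded (naturality of `ψ`): `Σ_j Σ_q (-1)^{j+q} ψ(c(ω_q (δ_j α))|)`. [cite: StacksProject, Tag 01FP] -/
theorem d_prismHomotopy_apply
    (hψ : ∀ ⦃s' t' : Finset ι'⦄ (hst : s' ⊆ t') (x : M.obj (s'.image θ ∪ s'.image θ')),
      (M'.map (homOfLE hst)).hom (ψ s' x) = ψ t' ((M.map (homOfLE (Finset.union_subset_union
        (Finset.image_subset_image hst) (Finset.image_subset_image hst)))).hom x))
    (n : ℕ) (c : Cochain M (n + 1)) (α : Fin (n + 2) → ι') :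
    ((complex M').d n (n + 1)).hom (prismHomotopy θ θ' ψ n c) α =
      ∑ j : Fin (n + 2), ∑ q : Fin (n + 1), ((-1 : A) ^ (j : ℕ) * (-1) ^ (q : ℕ)) •
        ψ (Finset.univ.image α) ((M.map (homOfLE ((image_prismTuple_subset θ θ' q (α ∘ Fin.succAbove j)).trans
          (Finset.union_subset_union (Finset.image_subset_image (image_comp_subset α (Fin.succAbove j)))
            (Finset.image_subset_image (image_comp_subset α (Fin.succAbove j))))))).hom
          (c (prismTuple θ θ' q (α ∘ Fin.succAbove j)))) := by
  rw [complex_d_apply]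
  refine Finset.sum_congr rfl fun j _ => ?_
  rw [prismHomotopy_apply, map_sum, Finset.smul_sum]
  refine Finset.sum_congr rfl fun q _ => ?_
  rw [map_smul, neg_one_pow_zsmul (A := A), smul_smul, hψ (image_comp_subset α (Fin.succAbove j)), map_map_apply]

/-- **THE PRISM HOMOTOPY IDENTITY on full cochains** (degrees `≥ 1`): `h(dc) + d'(hc) = Θ_{θ'} c − Θ_θ c` — the faces below
the joint of `ω_{q+1}` and above the joint of `ω_q` are the prisms of the faces `δ_j α`, adjacent prisms share the face through
the joint, and the two extreme faces are the `θ'`- and `θ`-pull-backs. [cite: StacksProject, Tag 01FP] -/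
theorem prismHomotopy_d_add_d_prismHomotopy
    (hψ : ∀ ⦃s' t' : Finset ι'⦄ (hst : s' ⊆ t') (x : M.obj (s'.image θ ∪ s'.image θ')),
      (M'.map (homOfLE hst)).hom (ψ s' x) = ψ t' ((M.map (homOfLE (Finset.union_subset_union
        (Finset.image_subset_image hst) (Finset.image_subset_image hst)))).hom x))
    (φ : imageFunctor θ ⋙ M ⟶ M') (φ' : imageFunctor θ' ⋙ M ⟶ M')
    (hφ : ∀ (s' : Finset ι') (x : M.obj (s'.image θ)),
      (φ.app s').hom x = ψ s' ((M.map (homOfLE Finset.subset_union_left)).hom x))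
    (hφ' : ∀ (s' : Finset ι') (x : M.obj (s'.image θ')),
      (φ'.app s').hom x = ψ s' ((M.map (homOfLE Finset.subset_union_right)).hom x))
    (n : ℕ) (c : Cochain M (n + 1)) (α : Fin (n + 2) → ι') :
    prismHomotopy θ θ' ψ (n + 1) (((complex M).d (n + 1) (n + 2)).hom c) α +
        ((complex M').d n (n + 1)).hom (prismHomotopy θ θ' ψ n c) α =
      pullbackCochain θ' φ' (n + 1) c α - pullbackCochain θ φ (n + 1) c α := by
  rw [prismHomotopy_d_apply, d_prismHomotopy_apply θ θ' ψ hψ]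
  rw [prism_sum_identity (A := A)
    (fun (p : Fin (n + 2)) (i : Fin (n + 3)) => ψ (Finset.univ.image α)
      ((M.map (homOfLE ((image_comp_subset _ (Fin.succAbove i)).trans (image_prismTuple_subset θ θ' p α)))).hom
        (c (prismTuple θ θ' p α ∘ Fin.succAbove i))))
    (fun (j : Fin (n + 2)) (q : Fin (n + 1)) => ψ (Finset.univ.image α)
      ((M.map (homOfLE ((image_prismTuple_subset θ θ' q (α ∘ Fin.succAbove j)).trans
        (Finset.union_subset_union (Finset.image_subset_image (image_comp_subset α (Fin.succAbove j)))
          (Finset.image_subset_image (image_comp_subset α (Fin.succAbove j))))))).hom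
        (c (prismTuple θ θ' q (α ∘ Fin.succAbove j)))))
    (fun q j hjq => congrArg (ψ _) (map_apply_congr c (prismTuple_succ_comp_succAbove_of_le θ θ' q j hjq α) _ _))
    (fun q j hqj => congrArg (ψ _) (map_apply_congr c (prismTuple_comp_succAbove_of_lt θ θ' q j hqj α) _ _))
    (fun q => congrArg (ψ _) (map_apply_congr c (prismTuple_castSucc_comp_succAbove_succ θ θ' q α) _ _))]
  congr 1
  · rw [pullbackCochain_apply, hφ']
    dsimp only [imageFunctor_obj, Functor.comp_obj]
    rw [map_map_apply]
    exact congrArg (ψ _) (map_apply_congr c (prismTuple_zero_comp_succAbove_zero θ θ' α) _ _)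
  · rw [pullbackCochain_apply, hφ]
    dsimp only [imageFunctor_obj, Functor.comp_obj]
    rw [map_map_apply]
    exact congrArg (ψ _) (map_apply_congr c (prismTuple_last_comp_succAbove_last θ θ' α) _ _)

/-- **The prism identity in degree `0`**: `h(dc) = Θ_{θ'} c − Θ_θ c` (no `d'h` term). [cite: StacksProject, Tag 01FP] -/
theorem prismHomotopy_d_zero (φ : imageFunctor θ ⋙ M ⟶ M') (φ' : imageFunctor θ' ⋙ M ⟶ M')
    (hφ : ∀ (s' : Finset ι') (x : M.obj (s'.image θ)),
      (φ.app s').hom x = ψ s' ((M.map (homOfLE Finset.subset_union_left)).hom x))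
    (hφ' : ∀ (s' : Finset ι') (x : M.obj (s'.image θ')),
      (φ'.app s').hom x = ψ s' ((M.map (homOfLE Finset.subset_union_right)).hom x))
    (c : Cochain M 0) :
    prismHomotopy θ θ' ψ 0 (((complex M).d 0 1).hom c) = pullbackCochain θ' φ' 0 c - pullbackCochain θ φ 0 c := by
  funext α
  rw [Pi.sub_apply, prismHomotopy_apply, Fin.sum_univ_one, Fin.val_zero, pow_zero, one_smul, complex_d_apply,
    map_sum, map_sum, Fin.sum_univ_two, Fin.val_zero, pow_zero, one_smul, Fin.val_one, pow_one, neg_one_zsmul,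
    map_neg, map_neg, map_map_apply, map_map_apply, ← sub_eq_add_neg]
  congr 1
  · rw [pullbackCochain_apply, hφ']
    dsimp only [imageFunctor_obj, Functor.comp_obj]
    rw [map_map_apply]
    exact congrArg (ψ _) (map_apply_congr c (prismTuple_zero_comp_succAbove_zero θ θ' α) _ _)
  · rw [pullbackCochain_apply, hφ]
    dsimp only [imageFunctor_obj, Functor.comp_obj]
    rw [map_map_apply]
    exact congrArg (ψ _) (map_apply_congr c (prismTuple_last_comp_succAbove_last θ θ' α) _ _)

end Prism

end Full

variable {ι : Type} [LinearOrder ι] {ι' : Type} [LinearOrder ι'] {A : Type u} [CommRing A]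

/-! ## §3 Transport to the ordered complex: `h_ord = res ∘ h ∘ ext` -/

section Ordered

variable {M : Finset ι ⥤ ModuleCat.{v} A} {M' : Finset ι' ⥤ ModuleCat.{v} A} (θ θ' : ι' → ι)
  (ψ : ∀ s' : Finset ι', M.obj (s'.image θ ∪ s'.image θ') →ₗ[A] M'.obj s')

/-- **The homotopy operator on ORDERED cochains** `h_ord : Č^{n+1}_ord(M) → Čⁿ_ord(M')` (all `n : ℤ`): `res ∘ h ∘ ext` — the prism
operator read through the alternating extension and the restriction to increasing tuples — in degrees `n ≥ 0`, and `0` in negative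
degrees. [cite: StacksProject, Tag 01FP] -/
def refineHomotopyMap : ∀ n : ℤ, SysCochain M (n + 1) →ₗ[A] SysCochain M' n
  | (n : ℕ) => Full.res M' n ∘ₗ Full.prismHomotopy θ θ' ψ n ∘ₗ Full.ext M (n + 1)
  | Int.negSucc _ => 0

/-- Unfolding `h_ord` in non-negative degrees. [cite: StacksProject, Tag 01FP] -/
theorem refineHomotopyMap_apply (n : ℕ) (g : SysCochain M ((n : ℤ) + 1)) :
    refineHomotopyMap θ θ' ψ n g = Full.res M' n (Full.prismHomotopy θ θ' ψ n (Full.ext M (n + 1) g)) := rfl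

/-- `h_ord` vanishes in negative degrees. [cite: StacksProject, Tag 01FP] -/
theorem refineHomotopyMap_negSucc (k : ℕ) : refineHomotopyMap (M := M) θ θ' ψ (Int.negSucc k) = 0 := rfl

variable (hψ : ∀ ⦃s' t' : Finset ι'⦄ (hst : s' ⊆ t') (x : M.obj (s'.image θ ∪ s'.image θ')),
    (M'.map (homOfLE hst)).hom (ψ s' x) = ψ t' ((M.map (homOfLE (Finset.union_subset_union
      (Finset.image_subset_image hst) (Finset.image_subset_image hst)))).hom x))
  (φ : imageFunctor θ ⋙ M ⟶ M') (φ' : imageFunctor θ' ⋙ M ⟶ M')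
  (hφ : ∀ (s' : Finset ι') (x : M.obj (s'.image θ)),
    (φ.app s').hom x = ψ s' ((M.map (homOfLE Finset.subset_union_left)).hom x))
  (hφ' : ∀ (s' : Finset ι') (x : M.obj (s'.image θ')),
    (φ'.app s').hom x = ψ s' ((M.map (homOfLE Finset.subset_union_right)).hom x))

include hψ hφ hφ' in
/-- **(G1-b) on ordered cochains, degrees `≥ 1`: `refine_{θ'} g − refine_θ g = d (h_ord g) + h_ord (d g)`** — transport of the
prism identity: `ext` and `res` are cochain maps (★ `Full.d_ext`, ★ `Full.sysD_res`) and `res ∘ Θ ∘ ext = refine`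
(★ `Full.res_pullbackCochain_ext`). [cite: StacksProject, Tag 01FP] -/
theorem refineCochain_sub_refineCochain_eq (n : ℕ) (g : SysCochain M ((n : ℤ) + 1)) :
    refineCochain θ' φ' ((n : ℤ) + 1) g - refineCochain θ φ ((n : ℤ) + 1) g =
      sysD M' n (refineHomotopyMap θ θ' ψ n g) + refineHomotopyMap θ θ' ψ ((n : ℤ) + 1) (sysD M ((n : ℤ) + 1) g) := by
  have hfull : (show Full.Cochain M' (n + 1) from
        ((Full.complex M').d n (n + 1)).hom (Full.prismHomotopy θ θ' ψ n (Full.ext M (n + 1) g))) +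
      Full.prismHomotopy θ θ' ψ (n + 1) (((Full.complex M).d (n + 1) (n + 2)).hom (Full.ext M (n + 1) g)) =
      Full.pullbackCochain θ' φ' (n + 1) (Full.ext M (n + 1) g) - Full.pullbackCochain θ φ (n + 1) (Full.ext M (n + 1) g) := by
    funext α
    rw [Pi.add_apply]
    exact (add_comm _ _).trans (Full.prismHomotopy_d_add_d_prismHomotopy θ θ' ψ hψ φ φ' hφ hφ' n (Full.ext M (n + 1) g) α)
  have er' : refineCochain θ' φ' ((n : ℤ) + 1) g =
      Full.res M' (n + 1) (Full.pullbackCochain θ' φ' (n + 1) (Full.ext M (n + 1) g)) :=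
    (Full.res_pullbackCochain_ext θ' φ' (n + 1) g).symm
  have er : refineCochain θ φ ((n : ℤ) + 1) g =
      Full.res M' (n + 1) (Full.pullbackCochain θ φ (n + 1) (Full.ext M (n + 1) g)) :=
    (Full.res_pullbackCochain_ext θ φ (n + 1) g).symm
  have e0 : refineHomotopyMap θ θ' ψ n g = Full.res M' n (Full.prismHomotopy θ θ' ψ n (Full.ext M (n + 1) g)) := rfl
  have e1 : refineHomotopyMap θ θ' ψ ((n : ℤ) + 1) (sysD M ((n : ℤ) + 1) g) =
      Full.res M' (n + 1) (Full.prismHomotopy θ θ' ψ (n + 1) (Full.ext M (n + 2) (sysD M ((n : ℤ) + 1) g))) := rfl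
  have ed : Full.ext M (n + 2) (sysD M ((n : ℤ) + 1) g) = ((Full.complex M).d (n + 1) (n + 2)).hom (Full.ext M (n + 1) g) :=
    (Full.d_ext M (n + 1) g).symm
  have hres := congrArg (Full.res M' (n + 1)) hfull
  rw [map_add, map_sub] at hres
  rw [er', er, e0, e1, ed, Full.sysD_res]
  exact hres.symm

include hφ hφ' in
/-- **(G1-b) on ordered cochains, degree `0`: `refine_{θ'} g − refine_θ g = h_ord (d g)`.** [cite: StacksProject, Tag 01FP] -/
theorem refineCochain_sub_refineCochain_eq_zero (g : SysCochain M 0) :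
    refineCochain θ' φ' 0 g - refineCochain θ φ 0 g = refineHomotopyMap θ θ' ψ 0 (sysD M 0 g) := by
  have er' : refineCochain θ' φ' 0 g = Full.res M' 0 (Full.pullbackCochain θ' φ' 0 (Full.ext M 0 g)) :=
    (Full.res_pullbackCochain_ext θ' φ' 0 g).symm
  have er : refineCochain θ φ 0 g = Full.res M' 0 (Full.pullbackCochain θ φ 0 (Full.ext M 0 g)) :=
    (Full.res_pullbackCochain_ext θ φ 0 g).symm
  have e1 : refineHomotopyMap θ θ' ψ 0 (sysD M 0 g) =
      Full.res M' 0 (Full.prismHomotopy θ θ' ψ 0 (Full.ext M 1 (sysD M 0 g))) := rfl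
  have ed : Full.ext M 1 (sysD M 0 g) = ((Full.complex M).d 0 1).hom (Full.ext M 0 g) := (Full.d_ext M 0 g).symm
  have hres := congrArg (Full.res M' 0) (Full.prismHomotopy_d_zero θ θ' ψ φ φ' hφ hφ' (Full.ext M 0 g))
  rw [map_sub] at hres
  rw [er', er, e1, ed]
  exact hres.symm

end Ordered

/-! ## §4 (G1-b) on classes (the refinement chain map is ★ DEF #15 `OrderedCech.refineComplexMap`, F0P1b-p02 (g2)) -/


section Classes

variable {M : Finset ι ⥤ ModuleCat.{v} A} {M' : Finset ι' ⥤ ModuleCat.{v} A} (θ θ' : ι' → ι)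
  (ψ : ∀ s' : Finset ι', M.obj (s'.image θ ∪ s'.image θ') →ₗ[A] M'.obj s')
  (hψ : ∀ ⦃s' t' : Finset ι'⦄ (hst : s' ⊆ t') (x : M.obj (s'.image θ ∪ s'.image θ')),
    (M'.map (homOfLE hst)).hom (ψ s' x) = ψ t' ((M.map (homOfLE (Finset.union_subset_union
      (Finset.image_subset_image hst) (Finset.image_subset_image hst)))).hom x))
  (φ : imageFunctor θ ⋙ M ⟶ M') (φ' : imageFunctor θ' ⋙ M ⟶ M')
  (hφ : ∀ (s' : Finset ι') (x : M.obj (s'.image θ)),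
    (φ.app s').hom x = ψ s' ((M.map (homOfLE Finset.subset_union_left)).hom x))
  (hφ' : ∀ (s' : Finset ι') (x : M.obj (s'.image θ')),
    (φ'.app s').hom x = ψ s' ((M.map (homOfLE Finset.subset_union_right)).hom x))

include hψ hφ hφ' in
/-- **(G1-b) INDEX-MAP INDEPENDENCE ON CLASSES** ([StacksProject, Tag 01FP]: «the maps `θ^*`, `θ'^*` are homotopic, hence induce
the same map on Čech cohomology»).  For CHARACTERISED cochain maps `F`, `F'` of ordered Čech complexes whose degree-wise
components are the refinements along `θ` and `θ'` (e.g. `refineComplexMap θ φ`, `refineComplexMap θ' φ'`), `H(F) = H(F')` in every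
degree: on cycles `F' z − F z = d (h_ord z)` is a boundary (degrees `≥ 1`), `= h_ord (d z) = 0` (degree `0`); negative degrees are
zero. [cite: StacksProject, Tag 01FP] -/
theorem homologyMap_eq_of_refine (F F' : sysComplex M ⟶ sysComplex M')
    (hF : ∀ (n : ℤ) (g : SysCochain M n), (F.f n).hom g = refineCochain θ φ n g)
    (hF' : ∀ (n : ℤ) (g : SysCochain M n), (F'.f n).hom g = refineCochain θ' φ' n g) (n : ℤ) :
    HomologicalComplex.homologyMap F n = HomologicalComplex.homologyMap F' n := by
  -- negative degrees: the source homology is zero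
  rcases lt_or_ge n 0 with hn | hn
  · have hz : Limits.IsZero ((sysComplex M).homology n) :=
      ((sysComplex M).sc n).isZero_homology_of_isZero_X₂ (isZero_sysComplex_X_of_neg M n hn)
    exact hz.eq_of_src _ _
  -- non-negative degrees: compare on cycles
  rw [← cancel_epi ((sysComplex M).homologyπ n), HomologicalComplex.homologyπ_naturality,
    HomologicalComplex.homologyπ_naturality]
  rcases eq_or_lt_of_le hn with h0 | hpos
  · -- degree 0: `F' z - F z = h_ord (d z) = 0` on cycles
    subst h0
    have key : HomologicalComplex.cyclesMap F' 0 = HomologicalComplex.cyclesMap F 0 := by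
      rw [← cancel_mono ((sysComplex M').iCycles 0), HomologicalComplex.cyclesMap_i, HomologicalComplex.cyclesMap_i]
      ext z
      have hdz : sysD M 0 (((sysComplex M).iCycles 0).hom z) = 0 := by
        have h := (sysComplex M).iCycles_d (0 : ℤ) (0 + 1)
        rw [sysComplex_d] at h
        exact congrArg (fun f => f.hom z) h
      have hz := refineCochain_sub_refineCochain_eq_zero θ θ' ψ φ φ' hφ hφ' (((sysComplex M).iCycles 0).hom z)
      rw [hdz, map_zero, sub_eq_zero] at hz
      simp only [ModuleCat.hom_comp, LinearMap.comp_apply]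
      rw [hF', hF]
      exact hz
    rw [key]
  · -- degree `m + 1`: `F' z - F z = d (h_ord z)` on cycles
    obtain ⟨m, rfl⟩ : ∃ m : ℕ, n = (m : ℤ) + 1 := ⟨(n - 1).toNat, by omega⟩
    have key : HomologicalComplex.cyclesMap F' ((m : ℤ) + 1) = HomologicalComplex.cyclesMap F ((m : ℤ) + 1) +
        (sysComplex M).iCycles _ ≫ ModuleCat.ofHom (refineHomotopyMap θ θ' ψ m) ≫
          (sysComplex M').toCycles (m : ℤ) ((m : ℤ) + 1) := by
      rw [← cancel_mono ((sysComplex M').iCycles _), HomologicalComplex.cyclesMap_i, Preadditive.add_comp,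
        HomologicalComplex.cyclesMap_i, Category.assoc, Category.assoc, HomologicalComplex.toCycles_i, sysComplex_d]
      ext z
      have hdz : sysD M ((m : ℤ) + 1) (((sysComplex M).iCycles ((m : ℤ) + 1)).hom z) = 0 := by
        have h := (sysComplex M).iCycles_d ((m : ℤ) + 1) ((m : ℤ) + 1 + 1)
        rw [sysComplex_d] at h
        exact congrArg (fun f => f.hom z) h
      have hz := refineCochain_sub_refineCochain_eq θ θ' ψ hψ φ φ' hφ hφ' m (((sysComplex M).iCycles _).hom z)
      rw [hdz, map_zero, add_zero, sub_eq_iff_eq_add'] at hz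
      simp only [ModuleCat.hom_comp, LinearMap.comp_apply, ModuleCat.hom_add, LinearMap.add_apply, ModuleCat.hom_ofHom]
      rw [hF', hF]
      exact hz
    rw [key, Preadditive.add_comp, Category.assoc, Category.assoc, HomologicalComplex.toCycles_comp_homologyπ,
      Limits.comp_zero, Limits.comp_zero, add_zero]

include hψ hφ hφ' in
/-- **(G1-b) for the refinement chain maps**: `H(refineComplexMap θ φ) = H(refineComplexMap θ' φ')` in every degree.
[cite: StacksProject, Tag 01FP] -/
theorem homologyMap_refineComplexMap_eq (n : ℤ) :
    HomologicalComplex.homologyMap (refineComplexMap θ φ) n = HomologicalComplex.homologyMap (refineComplexMap θ' φ') n :=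
  homologyMap_eq_of_refine θ θ' ψ hψ φ φ' hφ hφ' _ _ (fun _ _ => rfl) (fun _ _ => rfl) n

end Classes

end OrderedCech

end Literature.Algebra.Homology

end
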